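import Literature.AlgebraicGeometry.AbelianSchemes.RigidifiedGluingOfCechPic
import Literature.AlgebraicGeometry.AbelianSchemes.RigidifiedPicZeroFamiliesOfReducedBase
import Literature.AlgebraicGeometry.AbelianSchemes.AbelianSchemeDualTransport
import Literature.AlgebraicGeometry.Modules.PullbackTensor
import Literature.AlgebraicGeometry.Modules.TensorUnitors
import HarnessLib

/-!
# Tensor products of rigidified fibrewise-`Pic⁰` families; `(1_A × g)^*𝒫` as a rigidified family

Layer `Literature/AlgebraicGeometry/AbelianSchemes`, namespace `Literature.AlgebraicGeometry.AbelianSchemes.AbelianSchemeOver`.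
Cell `hodgecm-mathlib`, HECKE-LINK brick H2 file (ii), input (P-⊗) «the group law of `Â` is the `⊗`-law of rigidified
`Pic⁰` families» (sequel `PoincareSheafBiadditive`), part 1: the TEST OBJECTS of [MilneAV2008, I §8] (rigidified line
bundles on `A_T` lying fibrewise in `Pic⁰`) are closed under the tensor product of `𝒪_{A_T}`-modules, and the pull-backs
`(1_A × g)^*𝒫` of a Poincaré sheaf are such test objects.  Everything over ★ `AbelianSchemeDualPair` (`RigidifiedLineBundle`,
`FibrewisePicZero`, `DualPair.pullbackP`), ★ `Modules/TensorProduct` (`tensorObj`), ★ `Modules/PullbackTensor`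
(`pullbackTensorIso`: `f^*(M ⊗ N) ≅ f^*M ⊗ f^*N` for finite locally free `M, N`), ★ `Modules/TensorUnitors`
(`𝒪 ⊗ E ≅ E`), ★ `Modules/DetClassTensor` (`hasRank_tensorObj_one`).

* §1 `IsHomogeneous.tensorObj` — on an abelian variety over a field, the tensor product of two translation-invariant
  line bundles is translation invariant ([MumfordAV1970, §8]: `Pic⁰` is a subgroup of `Pic`).
* §2 `RigidifiedLineBundle.hasRank_one_tensorObj` / `rigid_tensorObj` / `fibrewisePicZero_tensorObj` — for rigidified
  families `ℒ, ℳ` on `A_T`: `ℒ ⊗ ℳ` has rank one, is rigidified along `ε_T` (`ε_T^*(ℒ ⊗ ℳ) ≅ ε_T^*ℒ ⊗ ε_T^*ℳ ≅ 𝒪 ⊗ 𝒪 ≅ 𝒪`)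
  and lies fibrewise in `Pic⁰` when `ℒ`, `ℳ` do; `FibrewisePicZero.of_iso` (transport along `ℒ.L ≅ ℳ.L`).
* §3 `DualPair.rigid_pullbackP` / `fibrewisePicZero_pullbackP` — `(1_A × g)^*𝒫` is a rigidified fibrewise-`Pic⁰` family on
  `A_T` for every `S`-morphism `g : T → Â` (the family CLASSIFIED by `g`); `nonempty_pullbackP_comp_unitSection_iso` —
  `(1_A × (f ≫ ε_Â))^*𝒫 ≅ 𝒪_{A_T}` under the unit hypothesis `𝒫|_{A × {ε_Â}} ≅ 𝒪` of ★ `AbelianSchemeDualTransport`.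

Theorems only (no def, no instance, no named fact, no sorry).  HC_CM is proved only modulo the 7 printed citations
until rung 0 closes; nothing here is about HC.

## References
* [MilneAV2008] J. S. Milne, *Abelian Varieties* (v2.00, 2008), I §8 pp. 36–37 (the dual as a universal object).
* [MumfordAV1970] D. Mumford, *Abelian Varieties* (1970), §8 (`Pic⁰`; (iv) ⇔ (i)), §13 (p. 125).
* [StacksProject] The Stacks Project, Tag 01CA (tensor product of modules, Lemma 17.16.4: pull-back).
-/

noncomputable section

universe u

open CategoryTheory CategoryTheory.Limits AlgebraicGeometry MonoidalCategory

-- `Scheme.Modules` / `SheafOfModules` are not reducible (as in Mathlib's `AlgebraicGeometry/Modules/Sheaf.lean`).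
set_option backward.isDefEq.respectTransparency false

namespace Literature.AlgebraicGeometry.AbelianVarieties

open Literature.AlgebraicGeometry.Motives Literature.AlgebraicGeometry.Modules

/-! ## §1 `Pic⁰` of an abelian variety is closed under `⊗` (translation invariance of a tensor product) -/

/-- **The tensor product of two translation-invariant finite locally free modules on an abelian variety is translation
invariant**: `t_P^*(E ⊗ F) ≅ t_P^*E ⊗ t_P^*F ≅ E ⊗ F` (★ `pullbackTensorIso`).  For line bundles this is «`Pic⁰(X)` is a
subgroup of `Pic(X)`». [cite: MumfordAV1970, §8 ((iv) ⇔ (i))] -/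
theorem IsHomogeneous.tensorObj {K : Type u} [Field K] {A : AbelianVariety K} {E F : A.X.left.Modules}
    (hE : IsFiniteLocallyFree E) (hF : IsFiniteLocallyFree F) (h₁ : IsHomogeneous A E) (h₂ : IsHomogeneous A F) :
    IsHomogeneous A (tensorObj E F) := by
  intro P
  obtain ⟨e₁⟩ := h₁ P
  obtain ⟨e₂⟩ := h₂ P
  exact ⟨pullbackTensorIso (A.translation P).left hE hF ≪≫ tensorMapIso e₁ e₂⟩

end Literature.AlgebraicGeometry.AbelianVarieties

namespace Literature.AlgebraicGeometry.AbelianSchemes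

namespace AbelianSchemeOver

open Literature.AlgebraicGeometry.Motives Literature.AlgebraicGeometry.AbelianVarieties
  Literature.AlgebraicGeometry.Modules

variable {S : Scheme.{u}} {A : AbelianSchemeOver S}

/-! ## §2 Tensor products of rigidified families on `A_T` -/

namespace RigidifiedLineBundle

variable {T : Scheme.{u}} {f : T ⟶ S} (ℒ ℳ : A.RigidifiedLineBundle f)

/-- `ℒ ⊗ ℳ` is a line bundle. [cite: MilneAV2008, I §8 pp. 36–37] -/
theorem hasRank_one_tensorObj : HasRank (tensorObj ℒ.L ℳ.L) 1 :=
  hasRank_tensorObj_one ℒ.hasRank_one ℳ.hasRank_one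

/-- **`ℒ ⊗ ℳ` is rigidified along `ε_T`**: `ε_T^*(ℒ ⊗ ℳ) ≅ ε_T^*ℒ ⊗ ε_T^*ℳ ≅ 𝒪_T ⊗ 𝒪_T ≅ 𝒪_T`.
[cite: MilneAV2008, I §8 pp. 36–37] -/
theorem rigid_tensorObj :
    Nonempty ((Scheme.Modules.pullback (A.baseChange f).unitSection).obj (tensorObj ℒ.L ℳ.L) ≅
      SheafOfModules.unit _) := by
  obtain ⟨r₁⟩ := ℒ.rigid
  obtain ⟨r₂⟩ := ℳ.rigid
  exact ⟨pullbackTensorIso (A.baseChange f).unitSection (HasRank.isFiniteLocallyFree' ℒ.hasRank_one)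
      (HasRank.isFiniteLocallyFree' ℳ.hasRank_one) ≪≫ tensorMapIso r₁ r₂ ≪≫ tensorUnitLeftIso _⟩

variable {ℒ ℳ}

/-- The fibrewise-`Pic⁰` condition depends only on the isomorphism class of the module: transport along `ℒ.L ≅ ℳ.L`
(two rigidified families over the same `f` with isomorphic modules). [cite: MumfordAV1970, §8 ((iv) ⇔ (i))] -/
theorem FibrewisePicZero.of_iso (e : ℒ.L ≅ ℳ.L) (h : ℒ.FibrewisePicZero) : ℳ.FibrewisePicZero := fun Ω _ _ t =>
  (isHomogeneous_iff_of_iso _ ((Scheme.Modules.pullback (pullback.fst (A.baseChange f).X.hom t)).mapIso e)).1 (h Ω t)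

variable (ℒ ℳ)

/-- **`ℒ ⊗ ℳ` lies fibrewise in `Pic⁰` when `ℒ` and `ℳ` do**: on the geometric fibre at `t`,
`(ℒ ⊗ ℳ)_t ≅ ℒ_t ⊗ ℳ_t` (★ `pullbackTensorIso`) is a tensor product of translation-invariant line bundles (§1).  Stated for
the rigidified family `⟨ℒ ⊗ ℳ, _, _⟩` assembled from `hasRank_one_tensorObj` and `rigid_tensorObj`.
[cite: MumfordAV1970, §8 ((iv) ⇔ (i))] [cite: MilneAV2008, I §8 pp. 36–37] -/
theorem fibrewisePicZero_tensorObj (h₁ : ℒ.FibrewisePicZero) (h₂ : ℳ.FibrewisePicZero) :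
    (⟨tensorObj ℒ.L ℳ.L, hasRank_one_tensorObj ℒ ℳ, rigid_tensorObj ℒ ℳ⟩ : A.RigidifiedLineBundle f).FibrewisePicZero := by
  intro Ω _ _ t
  have e := pullbackTensorIso (pullback.fst (A.baseChange f).X.hom t) (HasRank.isFiniteLocallyFree' ℒ.hasRank_one)
    (HasRank.isFiniteLocallyFree' ℳ.hasRank_one)
  refine (isHomogeneous_iff_of_iso _ e).2 ?_
  exact IsHomogeneous.tensorObj (HasRank.isFiniteLocallyFree' (hasRank_pullback _ ℒ.hasRank_one))
    (HasRank.isFiniteLocallyFree' (hasRank_pullback _ ℳ.hasRank_one)) (h₁ Ω t) (h₂ Ω t)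

end RigidifiedLineBundle

/-! ## §3 `(1_A × g)^*𝒫` as a rigidified fibrewise-`Pic⁰` family on `A_T` -/

namespace DualPair

variable (D : A.DualPair) {T : Scheme.{u}} (f : T ⟶ S)

/-- `(1_A × g)^*𝒫` is a line bundle. [cite: MilneAV2008, I §8 pp. 36–37] -/
theorem hasRank_one_pullbackP (g : T ⟶ D.hat.X.left) (hg : g ≫ D.hat.X.hom = f) : HasRank (D.pullbackP f g hg) 1 :=
  hasRank_pullback _ D.hasRank_one

/-- **`(1_A × g)^*𝒫` is rigidified along `ε_T`**: `ε_T ≫ (1_A × g) = g ≫ (ε_A × 1_Â)` (★ `unitSection_comp_baseChangeToProd`)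
and `𝒫` is normalised along `ε_A × 1_Â` (★ `nonempty_pullback_unitSection_baseChangeToProd_iso`).
[cite: MilneAV2008, I §8 pp. 36–37] [cite: MumfordFogartyKirwan1994, Ch. 6 §2 (p. 121)] -/
theorem rigid_pullbackP (g : T ⟶ D.hat.X.left) (hg : g ≫ D.hat.X.hom = f) :
    Nonempty ((Scheme.Modules.pullback (A.baseChange f).unitSection).obj (D.pullbackP f g hg) ≅ SheafOfModules.unit _) :=
  A.nonempty_pullback_unitSection_baseChangeToProd_iso D.hat D.P f g hg D.rigid

/-- `(1_A × (g ≫ 𝟙))^*𝒫 ≅ ((selfBundle D).comap g).L` on `A_{g ≫ π̂}`: the family classified by `g`, read through the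
restriction of `𝒫 = selfBundle D` along `g` (★ `nonempty_pullbackP_comp_iso_comap` at `𝟙_Â`, ★ `nonempty_pullbackP_id_iso`).
[cite: MilneAV2008, I §8 pp. 36–37] -/
theorem nonempty_pullbackP_iso_comap_selfBundle (g : T ⟶ D.hat.X.left) :
    Nonempty (D.pullbackP (g ≫ D.hat.X.hom) g rfl ≅ ((selfBundle D).comap g).L) := by
  have h := D.nonempty_pullbackP_comp_iso_comap g (selfBundle D) (g := 𝟙 _) (Category.id_comp _)
    (by rw [Category.comp_id]) (nonempty_pullbackP_id_iso D)
  have hc : D.pullbackP (g ≫ D.hat.X.hom) (g ≫ 𝟙 _) (by rw [Category.comp_id]) = D.pullbackP (g ≫ D.hat.X.hom) g rfl :=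
    D.pullbackP_congr _ (Category.comp_id g) _ _
  exact hc ▸ h

/-- **`(1_A × g)^*𝒫` lies fibrewise in `Pic⁰`** (clause (a) of the dual pair along `g`: it is the restriction of
`𝒫 = selfBundle D` along `g`, ★ `selfBundle_fibrewisePicZero` + ★ `FibrewisePicZero.comap`).  Stated for the rigidified
family `⟨(1_A × g)^*𝒫, _, _⟩` assembled from `hasRank_one_pullbackP` and `rigid_pullbackP`.
[cite: MumfordAV1970, §8 ((iv) ⇔ (i))] [cite: MilneAV2008, I §8 pp. 36–37] -/
theorem fibrewisePicZero_pullbackP (g : T ⟶ D.hat.X.left) (hg : g ≫ D.hat.X.hom = f) :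
    (⟨D.pullbackP f g hg, D.hasRank_one_pullbackP f g hg, D.rigid_pullbackP f g hg⟩ : A.RigidifiedLineBundle f).FibrewisePicZero := by
  subst hg
  obtain ⟨e⟩ := D.nonempty_pullbackP_iso_comap_selfBundle g
  exact RigidifiedLineBundle.FibrewisePicZero.of_iso (ℒ := (selfBundle D).comap g) e.symm
    ((selfBundle_fibrewisePicZero D).comap g)

/-- **`(1_A × (f ≫ ε_Â))^*𝒫 ≅ 𝒪_{A_T}` under the unit hypothesis `𝒫|_{A × {ε_Â}} ≅ 𝒪`** (the binder `hD` of ★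
`AbelianSchemeDualTransport`, discharged from a polarisation by ★ `AbelianSchemeDualTransportUnit`): the constant
`S`-morphism `T → S → Â` through the unit section classifies the trivial family.  (`(1_A × (f ≫ ε_Â))^*𝒫` is the
restriction along `f` of `(1_A × ε_Â)^*𝒫 ≅ 𝒪_A`, ★ `nonempty_pullbackP_unitSection_iso`.)  NOTE: the abstract `DualPair` does
not force this — translating the group law of `hat` by a section gives another dual pair with the same `P` — so `hD` is a
genuine hypothesis of every statement tying `Â`'s group law to `𝒫`. [cite: MilneAV2008, I §8 pp. 36–37] [cite: MumfordFogartyKirwan1994, Ch. 6 §2 (p. 121)] -/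
theorem nonempty_pullbackP_comp_unitSection_iso
    (hD : Nonempty ((Scheme.Modules.pullback (unitHatSlice D)).obj D.P ≅ SheafOfModules.unit _))
    (hf : (f ≫ D.hat.unitSection) ≫ D.hat.X.hom = f) :
    Nonempty (D.pullbackP f (f ≫ D.hat.unitSection) hf ≅ SheafOfModules.unit _) := by
  -- restriction along `f` of `(1_A × ε_Â)^*𝒫 ≅ 𝒪_{A_S}`
  have h := D.nonempty_pullbackP_comp_iso_comap f (trivialBundle A) (g := D.hat.unitSection) D.hat.unitSection_comp_hom
    (by rw [Category.assoc, D.hat.unitSection_comp_hom]) (D.nonempty_pullbackP_unitSection_iso hD)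
  -- `A_{f ≫ 𝟙} = A_f`: transport along `f ≫ 𝟙 S = f`
  have h' : Nonempty (D.pullbackP (f ≫ 𝟙 S) (f ≫ D.hat.unitSection)
      (by rw [Category.assoc, D.hat.unitSection_comp_hom]) ≅ SheafOfModules.unit _) :=
    h.map fun i => i ≪≫ (trivialBundle A).comapLIso f ≪≫ RigidifiedLineBundle.pullbackUnitIso _
  have key : ∀ (f' : T ⟶ S) (_ : f' = f) (h₁ : (f ≫ D.hat.unitSection) ≫ D.hat.X.hom = f'),
      Nonempty (D.pullbackP f' (f ≫ D.hat.unitSection) h₁ ≅ SheafOfModules.unit _) →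
        Nonempty (D.pullbackP f (f ≫ D.hat.unitSection) hf ≅ SheafOfModules.unit _) := by
    intro f' hf' h₁ hN
    subst hf'
    exact hN
  exact key (f ≫ 𝟙 S) (Category.comp_id f) _ h'

end DualPair

end AbelianSchemeOver

end Literature.AlgebraicGeometry.AbelianSchemes

end
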